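import Mathlib
import HarnessLib
import Summits.HubbardSuperconductivity.HubbardSuperconductivity.Theses.ChiralWindow
import Literature.MathematicalPhysics.QuantumLattice.DWaveOrderParameterProofs
import Literature.MathematicalPhysics.QuantumLattice.GroundStateSourceBounds
import Summits.HubbardSuperconductivity.HubbardSuperconductivity.Theorems.ChiralWindowCwChiralConstructionDiagonalTransfer
import Summits.HubbardSuperconductivity.HubbardSuperconductivity.Theorems.ChiralWindowCwChiralConstructionFreeBandLimit
import Summits.HubbardSuperconductivity.HubbardSuperconductivity.Theorems.ChiralWindowCwChiralConstructionSecondOrderEnergyBounds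
import Summits.HubbardSuperconductivity.HubbardSuperconductivity.Theorems.ChiralWindowCwChiralConstructionSlopeOfEnergyBounds
import Summits.HubbardSuperconductivity.HubbardSuperconductivity.Theorems.ChiralWindowCwChiralConstructionBudgetOfSlope
import Summits.HubbardSuperconductivity.HubbardSuperconductivity.Theorems.ChiralWindowCwChiralConstructionDensityOfLimits
import Summits.HubbardSuperconductivity.HubbardSuperconductivity.Theorems.WeakCouplingBCSWcbcsBcsConstructionEnergyDensityLimit

/-!
# Crux `CwChiralConstruction` (stmt-HubbardSuperconductivity-1740), line `susceptibility-rise-budget`: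
# the corner reduction (everything of the line except its constructive core)

Route `HubbardSuperconductivity/ChiralWindow`, rank-2 crux (the programme). Support file
(`--supports stmt-HubbardSuperconductivity-1740`, registered stub `stub_cruxOfCorner`). LINE (idea card
`Cruxes/CwChiralConstruction/Ideas/susceptibility-rise-budget.md`): the Koma–Tasaki floor
`exp(-C/U²) ≤ dWaveOrderParameter U μ` is obtained from ONE-POINT ORDER at a single doubly-sourced
corner `P* = (s₀, s₀)` (B₁g source `-s(Δ_d + Δ_d†)` and a partner co-source `-t·Y_L`) plus two
gap×variance TRANSPORT legs (`(s, s₀)`, `s ↓ h'`, then `(h', t)`, `t ↓ h'`) landing on the diagonal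
`(h', h')`, and the DIAGONAL TRANSFER `(h', h') → dWaveOrderParameter`.

This file assembles the landed pieces of the line into the exact implication

    (core data of `stub_chiralCornerWindow`)  →  `CwChiralConstruction`      (`stub_cruxOfCorner`),

so that the crux closes by modus ponens from its constructive core alone. Ingredients (all in the tree):
* `cw_susceptibilityBudget` — the gap×variance transport budget (crux-plan's `stub_susceptibilityBudget`),
  from `stub_secondOrderEnergyBounds` (…SecondOrderEnergyBounds.lean), `stub_slopeOfEnergyBounds`
  (…SlopeOfEnergyBounds.lean) and `stub_budgetOfSlope` (…BudgetOfSlope.lean);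
* `cw_genericDensity` — the density clause at a generic chemical potential (crux-plan's
  `stub_genericDensity`), from `stub_torusGcEnergyDensityLimit` (sibling crux, …EnergyDensityLimit.lean),
  `stub_freeBandLimit` (…FreeBandLimit.lean) and `stub_densityOfLimits` (…DensityOfLimits.lean);
* `cw_diagonalTransfer` (…DiagonalTransfer.lean).
Composition: the core gives (per `U`) a filling window and (per `μ`) the corner data; `cw_genericDensity`
picks `μ` in the window with a convergent density `1 - δ`, `δ ∈ [3/10, 12/25]`; two applications of the
budget (leg `(s, s₀)`, direction `O = Δ_d + Δ_d†`; leg `(h', t)`, direction `Y_L`) carry the corner value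
`2A(L+1)² ≤ Re ω(O)` to the diagonal `(h', h')` up to the two budgets; `Re ω(Δ_d) = ½ Re ω(O)` and the
core inequality give the floor `exp(-C/U²)` there, eventually in `L`, for every `h' ∈ (0, s₀)`; the
diagonal transfer concludes. No definitions; everything is proved. [folklore convexity + the cited pieces]
-/

set_option linter.dupNamespace false

namespace Summit.HubbardSuperconductivity.HubbardSuperconductivity.Theorems

open Literature.MathematicalPhysics.QuantumLattice Literature.Probability.LatticeModels Matrix Filter
open Summit.HubbardSuperconductivity.HubbardSuperconductivity.Theses.ChiralWindow
open scoped Matrix.Norms.L2Operator ComplexOrder Topology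

/-! ### Registered stubs -/

-- LANDED and imported (used by name below):
--   `stub_secondOrderEnergyBounds` — p81552 (…SecondOrderEnergyBounds.lean; lemmas p79041 …SecondOrderEnergyBoundsLemmas.lean)
--   `stub_slopeOfEnergyBounds`     — p84428 (…SlopeOfEnergyBounds.lean)
--   `stub_budgetOfSlope`           — p85426 (…BudgetOfSlope.lean)
--   `stub_gcEnergyTL`              — verbatim the sibling crux's accepted `stub_torusGcEnergyDensityLimit`
--                                    (p76736, WeakCouplingBCSWcbcsBcsConstructionEnergyDensityLimit.lean); used under that name
--   `stub_densityOfLimits`         — p85392 (…DensityOfLimits.lean)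

/-- **The gap×variance transport budget** (the crux-plan's registered `stub_susceptibilityBudget`,
now derived): along `K - tY`, `t ∈ [t₁, t₂]`, unique ground state of gap `≥ c t^a`, connected
fluctuations of `O` and `Y` `≤ V t^{-b}`, `a + b < 1` ⟹ the sourced one-point function of `O` moves by at
most `2V/(c(1-(a+b))) · (t₂^{1-(a+b)} - t₁^{1-(a+b)})`. [folklore: Kato, Hellmann–Feynman] -/
theorem cw_susceptibilityBudget :
    ∀ {n : Type} [Fintype n] [DecidableEq n] [Nonempty n] (K O Y : Matrix n n ℂ), K.IsHermitian → O.IsHermitian → Y.IsHermitian → ∀ (c V a b t₁ t₂ : ℝ), 0 < c → 0 ≤ V → a + b < 1 → 0 < t₁ → t₁ ≤ t₂ → (∀ t ∈ Set.Icc t₁ t₂, (K - (t : ℂ) • Y).HasSpectralGap (c * t ^ a)) → (∀ t ∈ Set.Icc t₁ t₂, ((K - (t : ℂ) • Y).groundStateFunctional (O * O)).re - ((K - (t : ℂ) • Y).groundStateFunctional O).re ^ 2 ≤ V * t ^ (-b)) → (∀ t ∈ Set.Icc t₁ t₂, ((K - (t : ℂ) • Y).groundStateFunctional (Y * Y)).re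 - ((K - (t : ℂ) • Y).groundStateFunctional Y).re ^ 2 ≤ V * t ^ (-b)) → |((K - (t₂ : ℂ) • Y).groundStateFunctional O).re - ((K - (t₁ : ℂ) • Y).groundStateFunctional O).re| ≤ 2 * V / (c * (1 - (a + b))) * (t₂ ^ (1 - (a + b)) - t₁ ^ (1 - (a + b))) :=
  stub_budgetOfSlope (stub_slopeOfEnergyBounds stub_secondOrderEnergyBounds)

-- `stub_freeBandLimit` LANDED — p86909 (ChiralWindowCwChiralConstructionFreeBandLimit.lean), imported above.

/-- **The density clause at a generic chemical potential** (the crux-plan's registered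
`stub_genericDensity`, now derived from `stub_torusGcEnergyDensityLimit` (sibling crux), `stub_freeBandLimit`, `stub_densityOfLimits`).
[folklore: Griffiths 1964; Ruelle 1969] -/
theorem cw_genericDensity :
    ∀ η : ℝ, 0 < η → ∃ U₁ : ℝ, 0 < U₁ ∧ ∀ U ∈ Set.Ioo (0 : ℝ) U₁, ∀ μ₁ μ₂ : ℝ, μ₁ < μ₂ → (∀ μ ∈ Set.Icc μ₁ μ₂, KohnLuttinger.filling (squareDispersion 1 0) μ ∈ Set.Icc (13 / 25 + η) (7 / 10 - η)) → ∃ μ ∈ Set.Ioo μ₁ μ₂, ∃ δ ∈ Set.Icc (3 / 10 : ℝ) (12 / 25), Tendsto (fun L : ℕ => ((hubbardTorusWith 2 (L + 1) 1 U μ).groundStateFunctional totalNumber).re / ((L + 1 : ℕ) : ℝ) ^ 2) atTop (𝓝 (1 - δ)) :=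
  stub_densityOfLimits stub_torusGcEnergyDensityLimit stub_freeBandLimit

-- Frame, part 1 (the diagonal transfer `cw_diagonal_fin`, `cw_diagonalTransfer` = registered `stub_diagonalTransfer`)
-- LANDED: p89015, ChiralWindowCwChiralConstructionDiagonalTransfer.lean (imported above).

/-! ### Frame, part 2: corner value + two transport legs ⟹ diagonal floor ⟹ the crux -/

/-- **Corner reduction** (registered as `stub_cruxOfCorner`). The corner data of the line's core stub
`stub_chiralCornerWindow` (taken here as the HYPOTHESIS, verbatim) imply the crux `CwChiralConstruction`:
the core gives (per `U`) the filling window and (per `μ`) the corner data; `cw_genericDensity` picks a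
`μ` in the window with a convergent density `1 - δ`, `δ ∈ [3/10, 12/25]`; two applications of
`cw_susceptibilityBudget` (leg `(s, s₀)`, direction `O`; leg `(h', t)`, direction `Y_L`) carry the
corner value `2A(L+1)² ≤ Re ω(O)` to the diagonal `(h', h')` up to the two budgets; `Re ω(Δ_d) = ½ Re ω(O)`
and the core inequality give the floor `exp(-C/U²)` there, eventually in `L`, for every `h' ∈ (0, s₀)`;
`cw_diagonalTransfer` concludes. -/
theorem stub_cruxOfCorner :
    (∃ η U₀ C : ℝ, 0 < η ∧ 0 < U₀ ∧ 0 < C ∧ ∀ U ∈ Set.Ioo (0 : ℝ) U₀, ∃ μ₁ μ₂ : ℝ, μ₁ < μ₂ ∧ (∀ μ ∈ Set.Icc μ₁ μ₂, KohnLuttinger.filling (squareDispersion 1 0) μ ∈ Set.Icc (13 / 25 + η) (7 / 10 - η)) ∧ ∀ μ ∈ Set.Ioo μ₁ μ₂, ∃ (Y : ∀ L : ℕ, Matrix (Finset (Orb (FermionTorus 2 (L + 1)))) (Finset (Orb (FermionTorus 2 (L + 1)))) ℂ) (bY s₀ A c V a b c₁ V₁ a₁ b₁ : ℝ), (∀ L,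 (Y L).IsHermitian) ∧ (∀ L, ‖Y L‖ ≤ bY * ((L + 1 : ℕ) : ℝ) ^ 2) ∧ 0 < s₀ ∧ 0 < c ∧ 0 ≤ V ∧ a + b < 1 ∧ 0 < c₁ ∧ 0 ≤ V₁ ∧ a₁ + b₁ < 1 ∧ Real.exp (-C / U ^ 2) ≤ A - V / (c * (1 - (a + b))) * s₀ ^ (1 - (a + b)) - V₁ / (c₁ * (1 - (a₁ + b₁))) * s₀ ^ (1 - (a₁ + b₁)) ∧ (∀ᶠ L : ℕ in atTop, A ≤ ((hubbardTorusWith 2 (L + 1) 1 U μ - (s₀ : ℂ) • Y L - (s₀ : ℂ) • (pairField dWaveFormFactor (L + 1) + (pairField dWaveFormFactor (L + 1))ᴴ) ).groundStateFunctional (pairField dWaveFormFactor (L + 1))).re / ((L + 1 : ℕ) : ℝ) ^ 2) ∧ ∀ h' ∈ Set.Ioo (0 : ℝ) s₀, ∀ᶠ L : ℕ in atTop, (∀ s ∈ Set.Icc h' s₀, (hubbardTorusWith 2 (L + 1) 1 U μ - (s₀ : ℂ) • Y L - (s : ℂ) • (pairField dWaveFormFactor (L + 1) + (pairField dWaveFormFactor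 (L + 1))ᴴ) ).HasSpectralGap (c * s ^ a) ∧ ((hubbardTorusWith 2 (L + 1) 1 U μ - (s₀ : ℂ) • Y L - (s : ℂ) • (pairField dWaveFormFactor (L + 1) + (pairField dWaveFormFactor (L + 1))ᴴ) ).groundStateFunctional ((pairField dWaveFormFactor (L + 1) + (pairField dWaveFormFactor (L + 1))ᴴ) * (pairField dWaveFormFactor (L + 1) + (pairField dWaveFormFactor (L + 1))ᴴ))).re - ((hubbardTorusWith 2 (L + 1) 1 U μ - (s₀ : ℂ) • Y L - (s : ℂ) • (pairField dWaveFormFactor (L + 1) + (pairField dWaveFormFactor (L + 1))ᴴ) ).groundStateFunctional (pairField dWaveFormFactor (L + 1) + (pairField dWaveFormFactor (L + 1))ᴴ)).re ^ 2 ≤ V * ((L + 1 : ℕ) : ℝ) ^ 2 * s ^ (-b)) ∧ (∀ t ∈ Set.Icc h' s₀, (dWaveSourceTorus (L + 1) U μ h' - (t : ℂ) • Y L).HasSpectralGap (c₁ * t ^ a₁) ∧ ((dWaveSourceTorus (L + 1) U μ h' - (t : ℂ) • Y L).groundStateFunctional ((pairField dWaveFormFactor (L + 1) + (pairField dWaveFormFactor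 (L + 1))ᴴ) * (pairField dWaveFormFactor (L + 1) + (pairField dWaveFormFactor (L + 1))ᴴ))).re - ((dWaveSourceTorus (L + 1) U μ h' - (t : ℂ) • Y L).groundStateFunctional (pairField dWaveFormFactor (L + 1) + (pairField dWaveFormFactor (L + 1))ᴴ)).re ^ 2 ≤ V₁ * ((L + 1 : ℕ) : ℝ) ^ 2 * t ^ (-b₁) ∧ ((dWaveSourceTorus (L + 1) U μ h' - (t : ℂ) • Y L).groundStateFunctional (Y L * Y L)).re - ((dWaveSourceTorus (L + 1) U μ h' - (t : ℂ) • Y L).groundStateFunctional (Y L)).re ^ 2 ≤ V₁ * ((L + 1 : ℕ) : ℝ) ^ 2 * t ^ (-b₁))) →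
    Summit.HubbardSuperconductivity.HubbardSuperconductivity.Theses.ChiralWindow.CwChiralConstruction := by
  intro hcore
  obtain ⟨η, U₀, C, hη, hU₀, hC, core⟩ := hcore
  obtain ⟨U₁, hU₁, dens⟩ := cw_genericDensity η hη
  refine ⟨min U₀ U₁, lt_min hU₀ hU₁, C, hC, fun U hU => ?_⟩
  have hUU₀ : U ∈ Set.Ioo (0 : ℝ) U₀ := ⟨hU.1, hU.2.trans_le (min_le_left _ _)⟩
  have hUU₁ : U ∈ Set.Ioo (0 : ℝ) U₁ := ⟨hU.1, hU.2.trans_le (min_le_right _ _)⟩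
  obtain ⟨μ₁, μ₂, h12, hfill, hcorner⟩ := core U hUU₀
  obtain ⟨μ, hμ, δ, hδ, hdens⟩ := dens U hUU₁ μ₁ μ₂ h12 hfill
  refine ⟨δ, hδ, μ, hdens, ?_⟩
  obtain ⟨Y, bY, s₀, A, c, V, a, b, c₁, V₁, a₁, b₁, hY, hYn, hs₀, hc, hV, hab, hc₁, hV₁, hab₁, hineq,
    hcornerval, hlegs⟩ := hcorner μ hμ
  refine cw_diagonalTransfer U μ _ bY Y hY hYn ⟨s₀, hs₀, fun h' hh' => ?_⟩
  have hh'pos : 0 < h' := hh'.1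
  have hh'le : h' ≤ s₀ := hh'.2.le
  set e₁ : ℝ := 1 - (a + b) with he₁
  set e₂ : ℝ := 1 - (a₁ + b₁) with he₂
  have he₁pos : 0 < e₁ := by rw [he₁]; linarith
  have he₂pos : 0 < e₂ := by rw [he₂]; linarith
  filter_upwards [hcornerval, hlegs h' hh'] with L hAL hlegL
  obtain ⟨hleg1, hleg2⟩ := hlegL
  -- notation
  set n2 : ℝ := ((L + 1 : ℕ) : ℝ) ^ 2 with hn2
  have hn2pos : 0 < n2 := cast_sq_pos_of_neZero (L + 1)
  set K := hubbardTorusWith 2 (L + 1) 1 U μ with hKdef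
  set P := pairField dWaveFormFactor (L + 1) with hPdef
  set O := P + Pᴴ with hOdef
  have hK : K.IsHermitian := isHermitian_hubbardTorusWith (L + 1) 1 U μ
  have hO : O.IsHermitian := isHermitian_pairField_add_conjTranspose (L + 1)
  have hsa : ∀ r : ℝ, IsSelfAdjoint (r : ℂ) := fun r => by
    rw [isSelfAdjoint_iff, Complex.star_def, Complex.conj_ofReal]
  -- leg 1: base `K₁ = K - s₀ Y_L`, direction `O`, observable `O`, `s ∈ [h', s₀]`
  set K₁ := K - (s₀ : ℂ) • Y L with hK₁def
  have hK₁ : K₁.IsHermitian := isHermitian_sub_real_smul hK (hY L) s₀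
  have budget1 := cw_susceptibilityBudget K₁ O O hK₁ hO hO c (V * n2) a b h' s₀ hc
    (mul_nonneg hV hn2pos.le) hab hh'pos hh'le
    (fun s hs => (hleg1 s hs).1) (fun s hs => (hleg1 s hs).2) (fun s hs => (hleg1 s hs).2)
  -- leg 2: base `K₂ = dWaveSourceTorus (L+1) U μ h'`, direction `Y_L`, observable `O`, `t ∈ [h', s₀]`
  set K₂ := dWaveSourceTorus (L + 1) U μ h' with hK₂def
  have hK₂ : K₂.IsHermitian := dWaveSourceTorus_isHermitian (L + 1) hK h'
  have budget2 := cw_susceptibilityBudget K₂ O (Y L) hK₂ hO (hY L) c₁ (V₁ * n2) a₁ b₁ h' s₀ hc₁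
    (mul_nonneg hV₁ hn2pos.le) hab₁ hh'pos hh'le
    (fun t ht => (hleg2 t ht).1) (fun t ht => (hleg2 t ht).2.1) (fun t ht => (hleg2 t ht).2.2)
  -- the two legs meet: `K₂ - s₀ Y = K₁ - h' O`
  have hmeet : K₂ - (s₀ : ℂ) • Y L = K₁ - (h' : ℂ) • O := by
    rw [hK₂def, hK₁def, dWaveSourceTorus_eq, sub_right_comm]
  -- corner value: `2 A n2 ≤ Re ω_{K₁ - s₀ O}(O)`
  have hcornerO : 2 * (A * n2) ≤ ((K₁ - (s₀ : ℂ) • O).groundStateFunctional O).re := by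
    have h1 : A * n2 ≤ ((K₁ - (s₀ : ℂ) • O).groundStateFunctional P).re := by
      have := (le_div_iff₀ hn2pos).1 hAL
      simpa [hK₁def, hOdef, hPdef, hKdef] using this
    rw [hOdef, map_add, Complex.add_re, groundStateFunctional_conjTranspose_re]
    linarith
  -- budgets: drop the `h'`-terms
  have hb1 : 2 * (V * n2) / (c * (1 - (a + b))) * (s₀ ^ (1 - (a + b)) - h' ^ (1 - (a + b))) ≤
      2 * n2 * (V / (c * (1 - (a + b))) * s₀ ^ (1 - (a + b))) := by
    have hpos : 0 ≤ 2 * (V * n2) / (c * (1 - (a + b))) := by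
      apply div_nonneg (by positivity)
      exact (mul_pos hc he₁pos).le
    have hh'pow : 0 ≤ h' ^ (1 - (a + b)) := Real.rpow_nonneg hh'pos.le _
    have : 2 * (V * n2) / (c * (1 - (a + b))) * (s₀ ^ (1 - (a + b)) - h' ^ (1 - (a + b))) ≤
        2 * (V * n2) / (c * (1 - (a + b))) * s₀ ^ (1 - (a + b)) :=
      mul_le_mul_of_nonneg_left (by linarith) hpos
    refine this.trans (le_of_eq ?_)
    field_simp
  have hb2 : 2 * (V₁ * n2) / (c₁ * (1 - (a₁ + b₁))) * (s₀ ^ (1 - (a₁ + b₁)) - h' ^ (1 - (a₁ + b₁))) ≤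
      2 * n2 * (V₁ / (c₁ * (1 - (a₁ + b₁))) * s₀ ^ (1 - (a₁ + b₁))) := by
    have hpos : 0 ≤ 2 * (V₁ * n2) / (c₁ * (1 - (a₁ + b₁))) := by
      apply div_nonneg (by positivity)
      exact (mul_pos hc₁ he₂pos).le
    have hh'pow : 0 ≤ h' ^ (1 - (a₁ + b₁)) := Real.rpow_nonneg hh'pos.le _
    have : 2 * (V₁ * n2) / (c₁ * (1 - (a₁ + b₁))) * (s₀ ^ (1 - (a₁ + b₁)) - h' ^ (1 - (a₁ + b₁))) ≤
        2 * (V₁ * n2) / (c₁ * (1 - (a₁ + b₁))) * s₀ ^ (1 - (a₁ + b₁)) :=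
      mul_le_mul_of_nonneg_left (by linarith) hpos
    refine this.trans (le_of_eq ?_)
    field_simp
  -- chain the inequalities on `Re ω(O)` down to the diagonal point `K₂ - h' Y`
  have hchain : 2 * (A * n2) - 2 * n2 * (V / (c * (1 - (a + b))) * s₀ ^ (1 - (a + b)))
      - 2 * n2 * (V₁ / (c₁ * (1 - (a₁ + b₁))) * s₀ ^ (1 - (a₁ + b₁))) ≤
      ((K₂ - (h' : ℂ) • Y L).groundStateFunctional O).re := by
    have l1 := (abs_le.1 budget1)
    have l2 := (abs_le.1 budget2)
    rw [hmeet] at l2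
    linarith [l1.1, l1.2, l2.1, l2.2, hcornerO, hb1, hb2]
  -- back to `Δ_d`: `Re ω(P) = ½ Re ω(O)` and the core inequality
  have hOre : ((K₂ - (h' : ℂ) • Y L).groundStateFunctional O).re =
      2 * ((K₂ - (h' : ℂ) • Y L).groundStateFunctional P).re := by
    rw [hOdef, map_add, Complex.add_re, groundStateFunctional_conjTranspose_re]; ring
  rw [le_div_iff₀ hn2pos]
  have hfin : Real.exp (-C / U ^ 2) * n2 ≤
      (A - V / (c * (1 - (a + b))) * s₀ ^ (1 - (a + b)) - V₁ / (c₁ * (1 - (a₁ + b₁))) * s₀ ^ (1 - (a₁ + b₁))) * n2 :=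
    mul_le_mul_of_nonneg_right hineq hn2pos.le
  rw [hOre] at hchain
  have : (A - V / (c * (1 - (a + b))) * s₀ ^ (1 - (a + b)) - V₁ / (c₁ * (1 - (a₁ + b₁))) * s₀ ^ (1 - (a₁ + b₁))) * n2
      ≤ ((K₂ - (h' : ℂ) • Y L).groundStateFunctional P).re := by nlinarith [hchain]
  exact hfin.trans this

end Summit.HubbardSuperconductivity.HubbardSuperconductivity.Theorems
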